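import Summits.QuantumFields.BalabanUV.T4Continuum.Spine.NE3.CurvedLandauNewtonStep
import HarnessLib

/-!
# NE7PointedLandauNewtonStep — ONE NEWTON STEP OF THE LANDAU SCHEME RELATIVE TO `W` ON THE POINTED GAUGE ALGEBRA: row NE3's `CurvedLandauNewtonStep.newton_step_W`
# with B8's mean-zero class `N(Q′(W))` replaced by the POINTED class `{μ skew periodic, μ(M•z) = 0}` — the corners of the gauge STAY PINNED (`u′(M•z) = 1`), the
# Landau defect contracts by the same `c_R·Θ`; step (b) of «REP WITH A FIXED TOP» (memo `t4/b2b-balaban-t4-ne7-p1-g76/TT-CURVED-LETTER.md` §8); file 14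

Cell `pub-balaban`, rung (B)+1 sub-cell t4, lineage `b2b-balaban-t4-ne7-p1` (CRUX PROVER NE7 #1 = OWNER of row NE7), generation 76.  File F80 — the MECHANICAL TWIN of
`Spine/NE3/CurvedLandauNewtonStep` (t4-ne3-p1 g27; letters 2b′ `CurvedLandauGaugeStep.gaugeAct_letters_W` ∕ `norm_covDiv_mlog_gaugeAct_sub_le_W`, `FlatLandauGaugeBond`,
`LandauProjectionB8` §1) on the pointed class; the projection feeding it is F79 `NE7PointedLandauProjection.exists_pointedLandau_correction`.
WHY (memo §2∕§7∕§8).  The curved (APE) needs a Landau representative whose gauge is pinned at the top corners.  E′'s Newton step sees the gauge class only through the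
membership predicate, the orthogonality and the two sup hypotheses (H0_W)∕(HR_W) BY SHAPE; THIS FILE re-runs it on the pointed class: the generator `λ` is skew, periodic and
`λ(M•z) = 0`, so `u′ = e^{λ}u` is pinned if `u` is (`e^0 = 1`) — the one new conclusion —, and the defect algebra is verbatim.  The pointed (H0_W)∕(HR_W) (`hG`, `hR` below) are
HYPOTHESES: their discharge (sup regularity of `Δ_W` with point constraints at the block corners) is the content of the brick and is NOT here.
WHAT ([folklore]; 0 def, 0 sorry).  §1 `sum_hsR_covDiv_add_covLapSite_eq_zero_of_pointedLandau` (the Euler–Lagrange form of the pointed Landau condition, by parts);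
§2 **`newton_step_W_pointed`** — `newton_step_W` with `avgKernelGauges` ↦ pointed, `IsLandauB8` ↦ pointed orthogonality, `u(M•z) = 1` in and OUT.
HONEST FRAMING (page 1): a twin of a tree file on OUR objects; the pointed sup letters and the scheme∕limit are NOT here; nothing of Bałaban's asserted; (APE) NOT proved; NOT
ONE-STEP, NOT NE7; spine 0∕9; finite T⁴ rung (B)+1 — NOT infinite volume, NOT mass gap, NOT `BetaPertH`, NOT Clay.  Continuum YM on T⁴ ⇐ BetaPertH ∧ nine spine estimates
(0/9 proved); BetaPertH ⇐ (D1) ∧ (D4) ∧ CAP+tail; G-an2-4 gates asym, D1 and NE2/3/4.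
-/

set_option autoImplicit false

open NormedSpace
open scoped BigOperators Matrix.Norms.L2Operator
open Finset

namespace Summit.QuantumFields.BalabanUV.T4Continuum.NE7PointedLandauNewtonStep

open Literature.MathematicalPhysics.QuantumFieldTheory.Balaban1983to89
open B7Prop1Explicit B7Prop2Explicit MatrixLog
open T4AveragingDeficitWall (Ad IsUnitaryCfg IsSkewDir)
open T4AveragingDeficitWallBoundary (IsPeriodicCfg periodBox)
open AveragingDeficitPeriodicCounting (IsPeriodicDir)
open AveragingDeficitTransport (norm_Ad_of_unitary mem_U1_of_unitary)
open NE3EnergyShapes (IsUnitarySite IsPeriodicSite)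
open NE3CovariantWeitzenbock (covDiv)
open NE3CurvedCornerGaugeSpace (covDiv_mem_skewAdjoint)
open NE3LandauOrbit (covDiv_add_period gaugeDir_skew sum_hsR_gaugeDir)
open NE3CovariantCalculus (hsR hsR_sub_left)
open NE3HilbertSchmidtTorus (covDiv_add_fun)
open BlockAveragePushDirGauge (gaugeDir isPeriodicDir_gaugeDir)
open NE3.PairLandauB8 (covLapSite)
open NE3.LandauProjectionB8 (covDiv_gaugeDir_eq_covLapSite covLapSite_add_period)
open NE3.FlatLandauGaugeBond (expGauge_unitary norm_expGauge_sub_one_le mlog_mem_skewAdjoint_of_unitary)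
open NE3.CurvedLandauGaugeStep (norm_covDiv_mlog_gaugeAct_sub_le_W gaugeAct_letters_W)
open NE3.CurvedLandauNewtonStep (isUnitaryCfg_gaugeAct_W isPeriodicDir_mlog_rel isSkewDir_mlog_rel covLapSite_skew)

noncomputable section

variable {d : ℕ} {n : Type*} [Fintype n] [DecidableEq n]

/-! ## §1 The Euler–Lagrange form of the pointed Landau condition -/

/-- **THE POINTED LANDAU CONDITION, SUMMED BY PARTS**: if `Σ_{x,κ} hsR (Y + D_Wλ)(gaugeDir W (Δ_W ν)) = 0` for a periodic `ν` (any test generator), then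
`Σ_x hsR (covDiv_W Y x + Δ_W λ x)(Δ_W ν x) = 0` (`sum_hsR_gaugeDir`, `covDiv ∘ gaugeDir = Δ_W`). [folklore] -/
theorem sum_hsR_covDiv_add_covLapSite_eq_zero_of_pointedLandau {P : ℕ} (hP : 1 ≤ P)
    {W : Site d → Fin d → (Matrix n n ℂ)ˣ} (hWu : IsUnitaryCfg W) (hWP : IsPeriodicCfg W (P : ℤ))
    {Y : Site d → Fin d → Matrix n n ℂ} (hYP : IsPeriodicDir Y (P : ℤ))
    {lam : Site d → Matrix n n ℂ} (hlamP : ∀ (y : Site d) (i : Fin d), lam (y + (P : ℤ) • e i) = lam y)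
    {nu : Site d → Matrix n n ℂ} (hnuP : ∀ (y : Site d) (i : Fin d), nu (y + (P : ℤ) • e i) = nu y)
    (h0 : ∑ x ∈ periodBox (d := d) P, ∑ κ : Fin d, hsR (Y x κ + gaugeDir W lam x κ) (gaugeDir W (covLapSite W nu) x κ) = 0) :
    ∑ x ∈ periodBox (d := d) P, hsR (covDiv W Y x + covLapSite W lam x) (covLapSite W nu x) = 0 := by
  have hZP : IsPeriodicDir (fun y κ => Y y κ + gaugeDir W lam y κ) (P : ℤ) := by
    intro y i μ
    show Y (y + (P : ℤ) • e i) μ + gaugeDir W lam (y + (P : ℤ) • e i) μ = Y y μ + gaugeDir W lam y μ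
    rw [hYP y i μ, isPeriodicDir_gaugeDir hWP hlamP y i μ]
  have hlapP : ∀ (y : Site d) (i : Fin d), covLapSite W nu (y + (P : ℤ) • e i) = covLapSite W nu y := covLapSite_add_period hWP hnuP
  have h0' : ∑ x ∈ periodBox (d := d) P, ∑ κ : Fin d,
      hsR ((fun y κ => Y y κ + gaugeDir W lam y κ) x κ) (gaugeDir W (covLapSite W nu) x κ) = 0 := h0
  rw [sum_hsR_gaugeDir hP hWu hZP hlapP] at h0'
  have hdiv : ∀ x : Site d, covDiv W (fun y κ => Y y κ + gaugeDir W lam y κ) x = covDiv W Y x + covLapSite W lam x := by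
    intro x
    rw [covDiv_add_fun, ← covDiv_gaugeDir_eq_covLapSite]
  simpa only [hdiv] using h0'

/-! ## §2 One Newton step on the pointed class -/

/-- **ONE NEWTON STEP OF THE LANDAU SCHEME RELATIVE TO `W` ON THE POINTED CLASS** (`newton_step_W`'s statement with the pointed class; the input gauge `u` is pinned at the
top corners and so is the output `u′ = e^{λ}u`). [folklore] -/
theorem newton_step_W_pointed [Nonempty n] (hd : 1 ≤ d) {L N : ℕ} (hL : 2 ≤ L) (hN : 1 ≤ N) (j : ℕ) {c₀ c₁ cR : ℝ}
    {W : Site d → Fin d → (Matrix n n ℂ)ˣ} (hWu : IsUnitaryCfg W) (hWP : IsPeriodicCfg W ((N * L ^ (j + 1) : ℕ) : ℤ))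
    (hG : ∀ mu : Site d → Matrix n n ℂ, ((∀ y, mu y ∈ skewAdjoint (Matrix n n ℂ)) ∧ (∀ (y : Site d) (i : Fin d), mu (y + ((N * L ^ (j + 1) : ℕ) : ℤ) • e i) = mu y) ∧
        (∀ w : Site d, mu ((((L ^ (j + 1) : ℕ) : ℤ)) • w) = 0)) → ∀ B : ℝ,
      (∀ y : Site d, ‖covLapSite W mu y‖ ≤ B) →
        (∀ y : Site d, ‖mu y‖ ≤ c₀ * ((L : ℝ) ^ (j + 1)) ^ 2 * B) ∧
        (∀ (y : Site d) (μ : Fin d), ‖gaugeDir W mu y μ‖ ≤ c₁ * (L : ℝ) ^ (j + 1) * B))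
    (hR : ∀ (F : Site d → Matrix n n ℂ), (∀ y : Site d, F y ∈ skewAdjoint (Matrix n n ℂ)) →
      (∀ (y : Site d) (i : Fin d), F (y + ((N * L ^ (j + 1) : ℕ) : ℤ) • e i) = F y) →
      ∀ mu : Site d → Matrix n n ℂ, ((∀ y, mu y ∈ skewAdjoint (Matrix n n ℂ)) ∧ (∀ (y : Site d) (i : Fin d), mu (y + ((N * L ^ (j + 1) : ℕ) : ℤ) • e i) = mu y) ∧
        (∀ w : Site d, mu ((((L ^ (j + 1) : ℕ) : ℤ)) • w) = 0)) →
        (∀ nu : Site d → Matrix n n ℂ, (∀ y, nu y ∈ skewAdjoint (Matrix n n ℂ)) →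
          (∀ (y : Site d) (i : Fin d), nu (y + ((N * L ^ (j + 1) : ℕ) : ℤ) • e i) = nu y) → (∀ w : Site d, nu ((((L ^ (j + 1) : ℕ) : ℤ)) • w) = 0) →
          ∑ y ∈ periodBox (d := d) (N * L ^ (j + 1)), hsR (F y + covLapSite W mu y) (covLapSite W nu y) = 0) →
        ∀ B : ℝ, (∀ y : Site d, ‖F y‖ ≤ B) → ∀ y : Site d, ‖covLapSite W mu y‖ ≤ cR * B)
    {U : Site d → Fin d → (Matrix n n ℂ)ˣ} (hUu : IsUnitaryCfg U) (hUP : IsPeriodicCfg U ((N * L ^ (j + 1) : ℕ) : ℤ))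
    {u : Site d → (Matrix n n ℂ)ˣ} (huU : IsUnitarySite u) (huP : IsPeriodicSite u ((N * L ^ (j + 1) : ℕ) : ℤ))
    (hu0 : ∀ w : Site d, u ((((L ^ (j + 1) : ℕ) : ℤ)) • w) = 1)
    {r b D : ℝ} (hr : ∀ (y : Site d) (μ : Fin d), ‖(((W y μ)⁻¹ * gaugeAct u U y μ : (Matrix n n ℂ)ˣ) : Matrix n n ℂ) - 1‖ ≤ r) (hr1 : r ≤ 1 / 20)
    (hb : ∀ x : Site d, ‖covDiv W (fun y μ => mlog (((W y μ)⁻¹ * gaugeAct u U y μ : (Matrix n n ℂ)ˣ) : Matrix n n ℂ)) x‖ ≤ b)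
    {lam : Site d → Matrix n n ℂ}
    (hlam : (∀ y, lam y ∈ skewAdjoint (Matrix n n ℂ)) ∧ (∀ (y : Site d) (i : Fin d), lam (y + ((N * L ^ (j + 1) : ℕ) : ℤ) • e i) = lam y) ∧
      (∀ w : Site d, lam ((((L ^ (j + 1) : ℕ) : ℤ)) • w) = 0))
    (hLan : ∀ nu : Site d → Matrix n n ℂ, (∀ y, nu y ∈ skewAdjoint (Matrix n n ℂ)) →
      (∀ (y : Site d) (i : Fin d), nu (y + ((N * L ^ (j + 1) : ℕ) : ℤ) • e i) = nu y) → (∀ w : Site d, nu ((((L ^ (j + 1) : ℕ) : ℤ)) • w) = 0) →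
      ∑ y ∈ periodBox (d := d) (N * L ^ (j + 1)), ∑ κ : Fin d,
        hsR (mlog (((W y κ)⁻¹ * gaugeAct u U y κ : (Matrix n n ℂ)ˣ) : Matrix n n ℂ) + gaugeDir W lam y κ) (gaugeDir W (covLapSite W nu) y κ) = 0)
    (hD : ∀ y : Site d, ‖covLapSite W lam y‖ ≤ D)
    (hΛ1 : c₀ * ((L : ℝ) ^ (j + 1)) ^ 2 * D ≤ 1 / 10) (hγ1 : c₁ * (L : ℝ) ^ (j + 1) * D ≤ 1 / 25)
    {u' : Site d → (Matrix n n ℂ)ˣ} (hu' : u' = fun y => expUnit (lam y) * u y)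
    {lam' : Site d → Matrix n n ℂ}
    (hlam' : (∀ y, lam' y ∈ skewAdjoint (Matrix n n ℂ)) ∧ (∀ (y : Site d) (i : Fin d), lam' (y + ((N * L ^ (j + 1) : ℕ) : ℤ) • e i) = lam' y) ∧
      (∀ w : Site d, lam' ((((L ^ (j + 1) : ℕ) : ℤ)) • w) = 0))
    (hLan' : ∀ nu : Site d → Matrix n n ℂ, (∀ y, nu y ∈ skewAdjoint (Matrix n n ℂ)) →
      (∀ (y : Site d) (i : Fin d), nu (y + ((N * L ^ (j + 1) : ℕ) : ℤ) • e i) = nu y) → (∀ w : Site d, nu ((((L ^ (j + 1) : ℕ) : ℤ)) • w) = 0) →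
      ∑ y ∈ periodBox (d := d) (N * L ^ (j + 1)), ∑ κ : Fin d,
        hsR (mlog (((W y κ)⁻¹ * gaugeAct u' U y κ : (Matrix n n ℂ)ˣ) : Matrix n n ℂ) + gaugeDir W lam' y κ) (gaugeDir W (covLapSite W nu) y κ) = 0) :
    IsUnitarySite u' ∧ IsPeriodicSite u' ((N * L ^ (j + 1) : ℕ) : ℤ) ∧ (∀ w : Site d, u' ((((L ^ (j + 1) : ℕ) : ℤ)) • w) = 1) ∧
    (∀ (y : Site d) (μ : Fin d), ‖(((W y μ)⁻¹ * gaugeAct u' U y μ : (Matrix n n ℂ)ˣ) : Matrix n n ℂ) - 1‖ ≤ r + 5 / 4 * (c₁ * (L : ℝ) ^ (j + 1) * D)) ∧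
    (∀ x : Site d, ‖covDiv W (fun y μ => mlog (((W y μ)⁻¹ * gaugeAct u' U y μ : (Matrix n n ℂ)ˣ) : Matrix n n ℂ)) x‖
      ≤ b + D + D * (4 * (c₀ * ((L : ℝ) ^ (j + 1)) ^ 2) * (b + D) + 25 * d * r * (c₁ * (L : ℝ) ^ (j + 1))
        + 14 * d * (c₁ * (L : ℝ) ^ (j + 1)) ^ 2 * D)) ∧
    (∀ y : Site d, ‖covLapSite W lam' y‖
      ≤ cR * (D * (4 * (c₀ * ((L : ℝ) ^ (j + 1)) ^ 2) * (b + D) + 25 * d * r * (c₁ * (L : ℝ) ^ (j + 1))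
        + 14 * d * (c₁ * (L : ℝ) ^ (j + 1)) ^ 2 * D))) ∧
    (∀ y : Site d, ‖(u' y : Matrix n n ℂ) - u y‖ ≤ 2 * (c₀ * ((L : ℝ) ^ (j + 1)) ^ 2 * D)) := by
  subst hu'
  set M : ℝ := (L : ℝ) ^ (j + 1) with hM
  have hL1 : 1 ≤ L := by omega
  have hP : 1 ≤ N * L ^ (j + 1) := Nat.mul_pos (by omega) (Nat.pow_pos (by omega))
  set Λ : ℝ := c₀ * M ^ 2 * D with hΛ_def
  set γ : ℝ := c₁ * M * D with hγ_def
  -- the current field and its letters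
  set V : Site d → Fin d → (Matrix n n ℂ)ˣ := gaugeAct u U with hV_def
  have hVu : IsUnitaryCfg V := isUnitaryCfg_gaugeAct_W huU hUu
  have hVP : IsPeriodicCfg V ((N * L ^ (j + 1) : ℕ) : ℤ) := NE3ResidualSliceRep.isPeriodicCfg_gaugeAct huP hUP
  have hZP : IsPeriodicDir (fun y μ => mlog (((W y μ)⁻¹ * V y μ : (Matrix n n ℂ)ˣ) : Matrix n n ℂ)) ((N * L ^ (j + 1) : ℕ) : ℤ) :=
    isPeriodicDir_mlog_rel hWP hVP
  have hZs : IsSkewDir (fun y μ => mlog (((W y μ)⁻¹ * V y μ : (Matrix n n ℂ)ˣ) : Matrix n n ℂ)) :=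
    isSkewDir_mlog_rel hWu hVu fun y μ => (hr y μ).trans (by linarith)
  -- the generator: skew, periodic; (H0_W)
  have hlams : ∀ y, lam y ∈ skewAdjoint (Matrix n n ℂ) := hlam.1
  have hlamP : ∀ (y : Site d) (i : Fin d), lam (y + ((N * L ^ (j + 1) : ℕ) : ℤ) • e i) = lam y := hlam.2.1
  obtain ⟨hΛ, hγ⟩ := hG lam hlam D hD
  have hΛle : Λ ≤ 1 / 10 := hΛ1
  have hγle : γ ≤ 1 / 25 := hγ1
  have hd' : 0 < d := hd
  have hΛ0 : 0 ≤ Λ := (norm_nonneg _).trans (hΛ 0)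
  have hγ0' : 0 ≤ γ := (norm_nonneg _).trans (hγ 0 ⟨0, hd'⟩)
  have hr0 : 0 ≤ r := (norm_nonneg _).trans (hr 0 ⟨0, hd'⟩)
  have hD0 : 0 ≤ D := (norm_nonneg _).trans (hD 0)
  have hb0 : 0 ≤ b := (norm_nonneg _).trans (hb 0)
  -- the new gauge `u′ = e^{λ}·u`
  set w : Site d → (Matrix n n ℂ)ˣ := fun y => expUnit (lam y) with hw_def
  have hw : ∀ y, (w y : Matrix n n ℂ) = exp (lam y) := fun y => rfl
  have hwU : IsUnitarySite w := expGauge_unitary hlams hw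
  have hwP : IsPeriodicSite w ((N * L ^ (j + 1) : ℕ) : ℤ) := fun y i => by simp only [hw_def, hlamP y i]
  have hprod : (fun y => expUnit (lam y) * u y) = w * u := rfl
  have hact : gaugeAct (fun y => expUnit (lam y) * u y) U = gaugeAct w V := by
    rw [hprod, B8Eq115GaugeFixing.gaugeAct_mul]
  have hu'U : IsUnitarySite (fun y => expUnit (lam y) * u y) := fun y => (unitaryUnits (Matrix n n ℂ)).mul_mem (hwU y) (huU y)
  have hu'P : IsPeriodicSite (fun y => expUnit (lam y) * u y) ((N * L ^ (j + 1) : ℕ) : ℤ) := fun y i => by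
    show expUnit (lam (y + ((N * L ^ (j + 1) : ℕ) : ℤ) • e i)) * u (y + ((N * L ^ (j + 1) : ℕ) : ℤ) • e i) = expUnit (lam y) * u y
    rw [hlamP y i, huP y i]
  -- NEW: the corners stay pinned
  have hu'0 : ∀ w : Site d, (fun y => expUnit (lam y) * u y) ((((L ^ (j + 1) : ℕ) : ℤ)) • w) = 1 := fun w => by
    show expUnit (lam ((((L ^ (j + 1) : ℕ) : ℤ)) • w)) * u ((((L ^ (j + 1) : ℕ) : ℤ)) • w) = 1
    rw [hlam.2.2 w, hu0 w, mul_one]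
    exact Units.ext (by rw [val_expUnit, exp_zero, Units.val_one])
  -- letter 2b′
  have hlet : ∀ (y : Site d) (μ : Fin d), ‖(((W y μ)⁻¹ * gaugeAct w V y μ : (Matrix n n ℂ)ˣ) : Matrix n n ℂ) - 1‖ ≤ r + 5 / 4 * γ ∧
      ‖mlog (((W y μ)⁻¹ * gaugeAct w V y μ : (Matrix n n ℂ)ˣ) : Matrix n n ℂ)‖ ≤ 2 * (r + 5 / 4 * γ) ∧
      mlog (((W y μ)⁻¹ * gaugeAct w V y μ : (Matrix n n ℂ)ˣ) : Matrix n n ℂ) ∈ skewAdjoint (Matrix n n ℂ) ∧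
      ((W y μ)⁻¹ * gaugeAct w V y μ : (Matrix n n ℂ)ˣ) ∈ unitaryUnits (Matrix n n ℂ) := fun y μ =>
    gaugeAct_letters_W hWu hVu hr hr1 hlams hΛ hΛle hγ hγle hw y μ
  have hJ : ∀ x : Site d, ‖covDiv W (fun y μ => mlog (((W y μ)⁻¹ * gaugeAct w V y μ : (Matrix n n ℂ)ˣ) : Matrix n n ℂ)) x
      - covDiv W (fun y μ => mlog (((W y μ)⁻¹ * V y μ : (Matrix n n ℂ)ˣ) : Matrix n n ℂ)) x - covLapSite W lam x‖
      ≤ D * (4 * (c₀ * M ^ 2) * (b + D) + 25 * d * r * (c₁ * M) + 14 * d * (c₁ * M) ^ 2 * D) := by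
    intro x
    have h := norm_covDiv_mlog_gaugeAct_sub_le_W hWu hVu hr hr1 hlams hΛ hΛle hγ hγle hw x
    have h2 : 4 * Λ * (‖covDiv W (fun y μ => mlog (((W y μ)⁻¹ * V y μ : (Matrix n n ℂ)ˣ) : Matrix n n ℂ)) x‖ + ‖covLapSite W lam x‖)
        + 25 * d * r * γ + 14 * d * γ ^ 2 ≤ 4 * Λ * (b + D) + 25 * d * r * γ + 14 * d * γ ^ 2 := by
      gcongr
      · exact hb x
      · exact hD x
    refine (h.trans h2).trans (le_of_eq ?_)
    simp only [hΛ_def, hγ_def]; ring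
  -- the new relative potential: periodic, skew
  have hV'P : IsPeriodicCfg (gaugeAct w V) ((N * L ^ (j + 1) : ℕ) : ℤ) := NE3ResidualSliceRep.isPeriodicCfg_gaugeAct hwP hVP
  have hZ'P : IsPeriodicDir (fun y μ => mlog (((W y μ)⁻¹ * gaugeAct w V y μ : (Matrix n n ℂ)ˣ) : Matrix n n ℂ)) ((N * L ^ (j + 1) : ℕ) : ℤ) :=
    isPeriodicDir_mlog_rel hWP hV'P
  have hZ's : IsSkewDir (fun y μ => mlog (((W y μ)⁻¹ * gaugeAct w V y μ : (Matrix n n ℂ)ˣ) : Matrix n n ℂ)) := fun y μ => (hlet y μ).2.2.1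
  -- (HR_W) on the junk `J`
  have hlam'P : ∀ (y : Site d) (i : Fin d), lam' (y + ((N * L ^ (j + 1) : ℕ) : ℤ) • e i) = lam' y := hlam'.2.1
  rw [hact] at hLan'
  set J : Site d → Matrix n n ℂ := fun x => covDiv W (fun y μ => mlog (((W y μ)⁻¹ * gaugeAct w V y μ : (Matrix n n ℂ)ˣ) : Matrix n n ℂ)) x
      - covDiv W (fun y μ => mlog (((W y μ)⁻¹ * V y μ : (Matrix n n ℂ)ˣ) : Matrix n n ℂ)) x - covLapSite W lam x with hJ_def
  have hJs : ∀ y, J y ∈ skewAdjoint (Matrix n n ℂ) := fun y =>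
    (skewAdjoint (Matrix n n ℂ)).sub_mem ((skewAdjoint (Matrix n n ℂ)).sub_mem (covDiv_mem_skewAdjoint hWu hZ's y)
      (covDiv_mem_skewAdjoint hWu hZs y)) (covLapSite_skew hWu hlams y)
  have hJP : ∀ (y : Site d) (i : Fin d), J (y + ((N * L ^ (j + 1) : ℕ) : ℤ) • e i) = J y := fun y i => by
    simp only [hJ_def, covDiv_add_period hWP hZ'P, covDiv_add_period hWP hZP, covLapSite_add_period hWP hlamP]
  have horth : ∀ nu : Site d → Matrix n n ℂ, (∀ y, nu y ∈ skewAdjoint (Matrix n n ℂ)) →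
      (∀ (y : Site d) (i : Fin d), nu (y + ((N * L ^ (j + 1) : ℕ) : ℤ) • e i) = nu y) → (∀ w : Site d, nu ((((L ^ (j + 1) : ℕ) : ℤ)) • w) = 0) →
      ∑ y ∈ periodBox (d := d) (N * L ^ (j + 1)), hsR (J y + covLapSite W lam' y) (covLapSite W nu y) = 0 := by
    intro nu hnus hnuP hnu0
    have E1 := sum_hsR_covDiv_add_covLapSite_eq_zero_of_pointedLandau hP hWu hWP hZ'P hlam'P hnuP (hLan' nu hnus hnuP hnu0)
    have E0 := sum_hsR_covDiv_add_covLapSite_eq_zero_of_pointedLandau hP hWu hWP hZP hlamP hnuP (hLan nu hnus hnuP hnu0)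
    have hpt : ∀ y : Site d, J y + covLapSite W lam' y
        = (covDiv W (fun y μ => mlog (((W y μ)⁻¹ * gaugeAct w V y μ : (Matrix n n ℂ)ˣ) : Matrix n n ℂ)) y + covLapSite W lam' y)
          - (covDiv W (fun y μ => mlog (((W y μ)⁻¹ * V y μ : (Matrix n n ℂ)ˣ) : Matrix n n ℂ)) y + covLapSite W lam y) := fun y => by
      simp only [hJ_def]; abel
    simp_rw [hpt, hsR_sub_left, Finset.sum_sub_distrib, E1, E0, sub_zero]
  have hD' : ∀ y : Site d, ‖covLapSite W lam' y‖
      ≤ cR * (D * (4 * (c₀ * M ^ 2) * (b + D) + 25 * d * r * (c₁ * M) + 14 * d * (c₁ * M) ^ 2 * D)) :=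
    hR J hJs hJP lam' hlam' horth _ hJ
  refine ⟨hu'U, hu'P, hu'0, ?_, ?_, hD', ?_⟩
  · intro y μ
    rw [hact]
    exact (hlet y μ).1
  · intro x
    rw [hact]
    have hid : covDiv W (fun y μ => mlog (((W y μ)⁻¹ * gaugeAct w V y μ : (Matrix n n ℂ)ˣ) : Matrix n n ℂ)) x
        = covDiv W (fun y μ => mlog (((W y μ)⁻¹ * V y μ : (Matrix n n ℂ)ˣ) : Matrix n n ℂ)) x + covLapSite W lam x + J x := by
      simp only [hJ_def]; abel
    rw [hid]
    calc _ ≤ ‖covDiv W (fun y μ => mlog (((W y μ)⁻¹ * V y μ : (Matrix n n ℂ)ˣ) : Matrix n n ℂ)) x‖ + ‖covLapSite W lam x‖ + ‖J x‖ := norm_add₃_le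
      _ ≤ b + D + D * (4 * (c₀ * M ^ 2) * (b + D) + 25 * d * r * (c₁ * M) + 14 * d * (c₁ * M) ^ 2 * D) :=
          add_le_add (add_le_add (hb x) (hD x)) (hJ x)
  · intro y
    have h1 : ((expUnit (lam y) * u y : (Matrix n n ℂ)ˣ) : Matrix n n ℂ) - u y = (exp (lam y) - 1) * (u y : Matrix n n ℂ) := by
      rw [Units.val_mul, val_expUnit, sub_mul, one_mul]
    have hu1 : ‖(u y : Matrix n n ℂ)‖ = 1 := CStarRing.norm_of_mem_unitary (mem_unitaryUnits.mp (huU y))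
    rw [h1]
    calc _ ≤ ‖exp (lam y) - 1‖ * ‖(u y : Matrix n n ℂ)‖ := norm_mul_le _ _
      _ ≤ 2 * Λ * 1 := by
          rw [hu1]
          exact mul_le_mul_of_nonneg_right ((hw y) ▸ norm_expGauge_sub_one_le hw hΛ (by linarith) y) zero_le_one
      _ = 2 * (c₀ * M ^ 2 * D) := by rw [hΛ_def]; ring

end

end Summit.QuantumFields.BalabanUV.T4Continuum.NE7PointedLandauNewtonStep
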